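import Mathlib
import HarnessLib
import Summits.NavierStokesRegularity.NavierStokesRegularity.Theorems.PoloidalWindowDoorPoloidalWindowRigidityTimeShearLiminfSource
import Summits.NavierStokesRegularity.NavierStokesRegularity.Theorems.PoloidalWindowDoorPoloidalWindowRigidityDecayingSlopeLiouville

/-!
# Route `PoloidalWindowDoor`, crux `PoloidalWindowRigidity` (K2, stmt-NavierStokesRegularity-19708), line `lrc-jet` —
# STUB `stub_tvLiminf`: the stratum (TV) «time-dependent proportional shear» with slope bounded ALONG A SEQUENCE of
# times `τ_k → −∞` is EMPTY in the class

Cell ns-regularity-ideate, seat ns-poloidal-K2-p2 gen 3 (stub-worker under the K2 lead ns-poloidal-K2-p1 g4; this file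
closes the registered stub `stub_tvLiminf` of `Cruxes/PoloidalWindowRigidity/Lines/lrc_jet.lean` v2 by name).

THE ARGUMENT (M12 run on the Clebsch weight `ψ = (1 − μ)v₂`).  On (TV) — every slice `s < 0` proportional-shear,
`∂₂v_b(s,·) ≡ μ(s)∂_b v₂(s,·)` (`b = 0,1`), `μ < 0` real-analytic — the shifted vertical residual `g̃ = f₂ − κv₂`
(`f = ∂ₜv + (v·∇)v − Δv = −∇p`, `κ = μ′/(1−μ)`) is height-only (ns-poloidal-K2-p3 g4 `…TimeShearVariance`), the
horizontal variance of `v₂` has no past whenever `μ ≥ −M` along some sequence `τ_k → −∞` (`…TimeShearLiminfDecay`), so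
the tested momentum equation makes `g̃(t,·)` constant in the height, hence SPATIALLY CONSTANT (`vresTV_eq_liminf`,
`vsub_const_liminf`).  Then `ψ = (1−μ(t))v₂` solves `∂ₜψ + (v·∇)ψ − Δψ = (1−μ)g̃ = c(t)` with a TIME-ONLY source and
slope `|ψ(t,x) − ψ(t,0)| ≤ (1−μ(t))(C₁/(−t))‖x‖`; the K2 lead's decaying-slope barrier
(`…DecayingSlopeLiouvilleKeyBound.key_bound`, nsreg-p7) run from the times `τ_k` ONLY — where
`(1−μ(τ_k))C₁/√(−τ_k) ≤ (1+M)C₁/√(−τ_k) → 0` — makes `ψ(t,·)`, hence `v₂(t,·)`, constant on every slice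
(`slice_const_of_decayingSlope_seq`, the SEQUENTIAL form of L4 `stub_decayingSlopeLiouville`, which as landed asks
`ε(t)√(−t) → 0` along ALL `t → −∞`); so `v·e₃` is flat along `e₀` and nsreg-p6's `…OneSlice.eq_zero_of_flat_slice`
ends: `v ≡ 0`.

* `slice_const_of_decayingSlope_seq` — the SEQUENTIAL decaying-slope Liouville lemma (any scalar `θ`; only
  `liminf_{t₀→−∞} ε(t₀)√(−t₀) = 0` is asked, via `…DecayingSlopeLiouvilleKeyBound.key_bound`);
(`…TimeShearLiminfSource.vsub_const_liminf`: `f₂ − κv₂` is spatially constant on every slice.)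
* `eq_zero_of_timeShear_liminf`, `nonflatLiouville_of_timeShear_liminf` — (TV) ∧ `∃ M, ∀ T, ∃ τ < T, −M ≤ μ τ` ⇒ `v ≡ 0`;
* `stub_tvLiminf` — the registered signature, verbatim (its non-constancy clause is not needed).

Complement: the K2 lead's zoom-out theorem for branch (G) `μ(τ) → −∞` (`…HorizontalFlatPast`); (B) ∨ (G) is all of (TV).

WHAT THIS IS NOT: not a claim about Navier–Stokes regularity and not LRC″ (`stub_lrcSpatial` stays open) — one of the
two registered stubs of the line `lrc-jet` (bears_on LADDER-NS N0, rung N0-LocalTubeDoorPoloidal, crux K2 = stmt-19708).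
-/

noncomputable section

-- the summit and its single sub-problem share the name (CONVENTIONS §1), as in every Theorems file
set_option linter.dupNamespace false

namespace Summit.NavierStokesRegularity.NavierStokesRegularity.Theorems.PoloidalWindowDoorPoloidalWindowRigidityTimeShearLiminf

open MeasureTheory Set Function Filter Topology Metric InnerProductSpace
open scoped RealInnerProductSpace InnerProductSpace Laplacian ContDiff
open Literature.Analysis Literature.Analysis.FluidPDE
open Summit.NavierStokesRegularity.NavierStokesRegularity.Theorems.LocalSineTubeDoorProfileAlignedWindowRigidityAncient
open Summit.NavierStokesRegularity.NavierStokesRegularity.Theorems.PoloidalWindowDoorPoloidalWindowRigidityWindow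
open Summit.NavierStokesRegularity.NavierStokesRegularity.Theorems.PoloidalWindowDoorPoloidalWindowRigidityFlat
open Summit.NavierStokesRegularity.NavierStokesRegularity.Theorems.PoloidalWindowDoorPoloidalWindowRigidityOneSlice
open Summit.NavierStokesRegularity.NavierStokesRegularity.Theorems.PoloidalWindowDoorPoloidalWindowRigidityClassRate
open Summit.NavierStokesRegularity.NavierStokesRegularity.Theorems.PoloidalWindowDoorPoloidalWindowRigidityScrewAssembly
open Summit.NavierStokesRegularity.NavierStokesRegularity.Theorems.PoloidalWindowDoorPoloidalWindowRigidityDecayingSlopeLiouvilleKeyBound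
open Summit.NavierStokesRegularity.NavierStokesRegularity.Theorems.PoloidalWindowDoorPoloidalWindowRigidityHorizontalMean
open Summit.NavierStokesRegularity.NavierStokesRegularity.Theorems.PoloidalWindowDoorPoloidalWindowRigidityConstantShearMeans
open Summit.NavierStokesRegularity.NavierStokesRegularity.Theorems.PoloidalWindowDoorPoloidalWindowRigidityConstantShearSlice
open Summit.NavierStokesRegularity.NavierStokesRegularity.Theorems.PoloidalWindowDoorPoloidalWindowRigidityConstantShearVariance
open Summit.NavierStokesRegularity.NavierStokesRegularity.Theorems.PoloidalWindowDoorPoloidalWindowRigidityConstantShearTest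
open Summit.NavierStokesRegularity.NavierStokesRegularity.Theorems.PoloidalWindowDoorPoloidalWindowRigidityTimeShearVariance
open Summit.NavierStokesRegularity.NavierStokesRegularity.Theorems.PoloidalWindowDoorPoloidalWindowRigidityTimeShearTest
open Summit.NavierStokesRegularity.NavierStokesRegularity.Theorems.PoloidalWindowDoorPoloidalWindowRigidityTimeShearLiminfDecay
open Summit.NavierStokesRegularity.NavierStokesRegularity.Theorems.PoloidalWindowDoorPoloidalWindowRigidityTimeShearLiminfSource

variable {v : ℝ → EuclideanSpace ℝ (Fin 3) → EuclideanSpace ℝ (Fin 3)} {C : ℝ}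

section Class

variable (hrate : HasTypeITimeDecay C v) (hcont : ContinuousOn (uncurry v) (Iio (0 : ℝ) ×ˢ univ))
  (hmild : ∀ s t : ℝ, s < t → t < 0 → ∀ x,
    v t x = UnboundedOperators.heatExtension (v s) (t - s) x - oseenDuhamel 1 s v v t x)
  (hdiv : ∀ t < 0, VectorCalculus.IsDivFree (v t))
  (hpol : ∀ s < 0, ∀ y, ⟪curl (v s) y, EuclideanSpace.single 2 1⟫_ℝ = 0)
  {μ : ℝ → ℝ} (hμneg : ∀ s < 0, μ s < 0)
  (hslope : ∀ s < 0, ∀ y, ∀ b : Fin 3, b ≠ 2 →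
    fderiv ℝ (v s) y (EuclideanSpace.single 2 1) b = μ s * fderiv ℝ (v s) y (EuclideanSpace.single b 1) 2)

include hrate hcont hmild hdiv hpol hμneg hslope

/-! ### The SEQUENTIAL decaying-slope Liouville lemma -/

omit hdiv hpol hμneg hslope hmild in
/-- **Sequential form of the K2 lead's L4 (`…DecayingSlopeLiouville.stub_decayingSlopeLiouville`).**  Along a profile of
the Type-I class, a scalar `θ`, jointly `C²` on the open slab, solving `∂ₜθ + (v·∇)θ − Δθ = c(t)` (time-only source),
with slope `|θ(t,x) − θ(t,0)| ≤ ε(t)‖x‖`, `ε` continuous on `(−∞,0)`, and `ε(t₀)√(−t₀)` ARBITRARILY SMALL AT ARBITRARILY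
EARLY TIMES (`∀ δ > 0, ∀ T, ∃ t₀ < T, ε t₀ √(−t₀) < δ` — a liminf, not a limit), is constant on every slice.  Proof: the
barrier bound `key_bound` at `t₁` from such a `t₀` gives `|θ(t₁,x) − θ(t₁,0)| ≤ 2(5 + 4C)·ε(t₀)√(−t₀)` once
`‖x‖² ≤ −t₀`. -/
theorem slice_const_of_decayingSlope_seq (θ : ℝ → EuclideanSpace ℝ (Fin 3) → ℝ) (src : ℝ → ℝ) (ε : ℝ → ℝ)
    (hθ : ContDiffOn ℝ 2 (uncurry θ) (Iio (0 : ℝ) ×ˢ univ))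
    (heq : ∀ t < 0, ∀ x, deriv (fun τ => θ τ x) t + fderiv ℝ (θ t) x (v t x) - (Δ (θ t)) x = src t)
    (hsl : ∀ t < 0, ∀ x, |θ t x - θ t 0| ≤ ε t * ‖x - 0‖) (hεc : ContinuousOn ε (Iio 0))
    (hseq : ∀ δ : ℝ, 0 < δ → ∀ T : ℝ, ∃ t₀ < T, ε t₀ * Real.sqrt (-t₀) < δ) :
    ∀ t < 0, ∀ x, θ t x = θ t 0 := by
  intro t₁ ht₁ x
  have hC : 0 ≤ C := by
    have h := hrate (-1) (by norm_num) 0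
    rw [neg_neg, Real.sqrt_one, div_one] at h
    exact (norm_nonneg _).trans h
  have hε0 : ∀ t < 0, 0 ≤ ε t := by
    intro t ht
    have h := hsl t ht (0 + EuclideanSpace.single 0 1)
    have hn : ‖(0 : EuclideanSpace ℝ (Fin 3)) + EuclideanSpace.single 0 (1:ℝ) - 0‖ = 1 := by
      rw [add_sub_cancel_left, PiLp.norm_single, norm_one]
    rw [hn, mul_one] at h
    exact (abs_nonneg _).trans h
  set K : ℝ := 5 + 4 * C with hK
  have hK0 : 0 < K := by positivity
  -- `|θ t₁ x − θ t₁ 0| ≤ η` for every `η > 0`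
  have key : ∀ η : ℝ, 0 < η → |θ t₁ x - θ t₁ 0| ≤ η := by
    intro η hη
    obtain ⟨t₀, ht₀T, hsmall⟩ := hseq (η / (2 * K)) (by positivity) (min t₁ (-(‖x - 0‖ ^ 2 + 1)))
    have ht₀₁ : t₀ < t₁ := lt_of_lt_of_le ht₀T (min_le_left _ _)
    have ht₀x : ‖x - 0‖ ^ 2 + 1 ≤ -t₀ := by
      have h := lt_of_lt_of_le ht₀T (min_le_right _ _)
      linarith
    have ht₀ : t₀ < 0 := ht₀₁.trans ht₁
    have hnt₀ : 0 < -t₀ := neg_pos.2 ht₀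
    set s : ℝ := Real.sqrt (-t₀) with hs
    have hs0 : 0 < s := Real.sqrt_pos.2 hnt₀
    have hss : s * s = -t₀ := Real.mul_self_sqrt hnt₀.le
    have hsne : s ≠ 0 := hs0.ne'
    have hb := key_bound hrate hcont hθ heq hsl hεc ht₀₁ ht₁ t₁ (right_mem_Icc.2 ht₀₁.le)
    -- the barrier bracket is `≤ K s` at `y = x` and at `y = 0`
    have hbr : ∀ y : EuclideanSpace ℝ (Fin 3), ‖y - 0‖ ^ 2 ≤ -t₀ →
        Real.sqrt (‖y - 0‖ ^ 2 + 3 * (-t₀)) +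
          (4 * C * (Real.sqrt (-t₀) - Real.sqrt (-t₁)) + 3 / Real.sqrt (3 * (-t₀)) * (t₁ - t₀)) ≤ K * s := by
      intro y hy
      have h1 : Real.sqrt (‖y - 0‖ ^ 2 + 3 * (-t₀)) ≤ 2 * s := by
        have hle : ‖y - 0‖ ^ 2 + 3 * (-t₀) ≤ (2 * s) * (2 * s) := by nlinarith
        calc Real.sqrt (‖y - 0‖ ^ 2 + 3 * (-t₀)) ≤ Real.sqrt ((2 * s) * (2 * s)) := Real.sqrt_le_sqrt hle
          _ = 2 * s := Real.sqrt_mul_self (by positivity)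
      have h2 : 4 * C * (Real.sqrt (-t₀) - Real.sqrt (-t₁)) ≤ 4 * C * s := by
        rw [← hs]
        have : 0 ≤ Real.sqrt (-t₁) := Real.sqrt_nonneg _
        nlinarith
      have h3 : 3 / Real.sqrt (3 * (-t₀)) * (t₁ - t₀) ≤ 3 * s := by
        have hq : 3 / Real.sqrt (3 * (-t₀)) ≤ 3 / s :=
          div_le_div_of_nonneg_left (by norm_num) hs0 (by rw [hs]; exact Real.sqrt_le_sqrt (by linarith))
        have hq0 : 0 ≤ 3 / Real.sqrt (3 * (-t₀)) := by positivity
        have hdt : t₁ - t₀ ≤ -t₀ := by linarith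
        calc 3 / Real.sqrt (3 * (-t₀)) * (t₁ - t₀) ≤ 3 / s * (-t₀) :=
              mul_le_mul hq hdt (by linarith) (by positivity)
          _ = 3 * s := by rw [← hss]; field_simp
      rw [hK]
      linarith
    have hx1 := (hb x).trans (mul_le_mul_of_nonneg_left (hbr x (by linarith)) (hε0 t₀ ht₀))
    have hx0 := (hb 0).trans (mul_le_mul_of_nonneg_left (hbr 0 (by simpa using hnt₀.le)) (hε0 t₀ ht₀))
    have hdiff : |θ t₁ x - θ t₁ 0| ≤ 2 * (ε t₀ * (K * s)) := by
      have e : θ t₁ x - θ t₁ 0 = (θ t₁ x - θ t₀ 0 - ∫ τ in t₀..t₁, src τ) -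
          (θ t₁ 0 - θ t₀ 0 - ∫ τ in t₀..t₁, src τ) := by ring
      rw [e]
      calc _ ≤ |θ t₁ x - θ t₀ 0 - ∫ τ in t₀..t₁, src τ| + |θ t₁ 0 - θ t₀ 0 - ∫ τ in t₀..t₁, src τ| := abs_sub _ _
        _ ≤ ε t₀ * (K * s) + ε t₀ * (K * s) := add_le_add hx1 hx0
        _ = _ := by ring
    have hfin : 2 * (ε t₀ * (K * s)) ≤ η := by
      have h := mul_le_mul_of_nonneg_left hsmall.le (by positivity : (0:ℝ) ≤ 2 * K)
      have e1 : 2 * K * (ε t₀ * s) = 2 * (ε t₀ * (K * s)) := by ring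
      have e2 : 2 * K * (η / (2 * K)) = η := by field_simp
      linarith [e1, e2]
    exact hdiff.trans hfin
  have h0 : |θ t₁ x - θ t₁ 0| ≤ 0 := by
    by_contra hne
    push Not at hne
    have h := key (|θ t₁ x - θ t₁ 0| / 2) (by positivity)
    linarith
  exact sub_eq_zero.1 (abs_eq_zero.1 (le_antisymm h0 (abs_nonneg _)))

/-! ### The stub -/

/-- **(TV) WITH SLOPE BOUNDED ALONG A SEQUENCE ⇒ `v ≡ 0`.**  A profile of the route's Type-I class, poloidal along
`e₃`, with all-slices proportional shear `∂₂v_b(s,·) ≡ μ(s)∂_b v₂(s,·)` (`b = 0,1`), `μ < 0` real-analytic at every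
`s < 0`, and `μ ≥ −M` along some sequence of times tending to `−∞`, vanishes identically. -/
theorem eq_zero_of_timeShear_liminf (hμa : ∀ s < 0, AnalyticAt ℝ μ s) {M : ℝ} (hM : ∀ T : ℝ, ∃ τ < T, -M ≤ μ τ) :
    ∀ t < 0, ∀ x, v t x = 0 := by
  have hμd : ∀ s < 0, DifferentiableAt ℝ μ s := fun s hs => (hμa s hs).differentiableAt
  have hA : IsTypeIAncientMild C v := isTypeIAncientMild_of_class hrate hcont hmild hdiv
  have hsm : IsSmoothSpaceTimeOn (Iio (0 : ℝ)) v := hA.contDiffOn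
  obtain ⟨C₁, hC₁⟩ := exists_fderiv_rate_of_class hrate hcont hmild
  have hC₁0 : 0 ≤ C₁ := by
    have h := (norm_nonneg _).trans (hC₁ (-1) (by norm_num) 0)
    rw [neg_neg, div_one] at h
    exact h
  have hm : ∀ t < 0, 0 < 1 - μ t := fun t ht => by linarith [hμneg t ht]
  -- ## the Clebsch weight `θ = (1 − μ) v₂`, its source and slope rate
  set θ : ℝ → EuclideanSpace ℝ (Fin 3) → ℝ := fun t y => (1 - μ t) * v t y 2 with hθdef
  set κ : ℝ → ℝ := fun t => deriv μ t / (1 - μ t) with hκ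
  set src : ℝ → ℝ := fun t => (1 - μ t) *
    ((timeDerivWithin (Iio 0) v t 0 + convect (v t) (v t) 0 - Δ (v t) 0) 2 - κ t * v t 0 2) with hsrc
  set ε : ℝ → ℝ := fun t => (1 - μ t) * (C₁ / (-t)) with hεdef
  -- ## joint `C²`
  have hμ2 : ContDiffOn ℝ 2 μ (Iio 0) := fun s hs => ((hμa s hs).contDiffAt).contDiffWithinAt
  have hθ : ContDiffOn ℝ 2 (uncurry θ) (Iio (0 : ℝ) ×ˢ univ) := by
    have h1 : ContDiffOn ℝ 2 (fun p : ℝ × EuclideanSpace ℝ (Fin 3) => 1 - μ p.1) (Iio (0 : ℝ) ×ˢ univ) :=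
      contDiffOn_const.sub (hμ2.comp contDiffOn_fst fun p hp => (mem_prod.1 hp).1)
    have h2 : ContDiffOn ℝ 2 (fun p : ℝ × EuclideanSpace ℝ (Fin 3) => v p.1 p.2 2) (Iio (0 : ℝ) ×ˢ univ) :=
      (EuclideanSpace.proj (𝕜 := ℝ) (2 : Fin 3)).contDiff.comp_contDiffOn (contDiffOn_infty.1 hA.contDiffOn 2)
    exact h1.mul h2
  -- ## the equation `∂ₜθ + (v·∇)θ − Δθ = src t`
  have heq : ∀ t < 0, ∀ x, deriv (fun τ => θ τ x) t + fderiv ℝ (θ t) x (v t x) - (Δ (θ t)) x = src t := by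
    intro t ht x
    have hμ' : HasDerivAt μ (deriv μ t) t := (hμd t ht).hasDerivAt
    have h2 : ContDiff ℝ 2 (fun y => v t y 2) := contDiff_coord ((hA.contDiff_slice ht).of_le (by norm_cast)) 2
    have h2d : Differentiable ℝ (fun y => v t y 2) := h2.differentiable (by norm_num)
    -- time derivative (product rule)
    have hvline : HasDerivAt (fun τ => v τ x 2) (deriv (fun s => v s x) t 2) t :=
      hasDerivAt_vert hrate hcont hmild hdiv ht x
    have hθline : HasDerivAt (fun τ => θ τ x)
        ((0 - deriv μ t) * v t x 2 + (1 - μ t) * deriv (fun s => v s x) t 2) t :=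
      ((hasDerivAt_const t (1 : ℝ)).sub hμ').mul hvline
    have hT := hθline.deriv
    -- convective term and Laplacian
    have hX : fderiv ℝ (θ t) x (v t x) = (1 - μ t) * fderiv ℝ (fun y => v t y 2) x (v t x) := by
      show fderiv ℝ (fun y => (1 - μ t) * v t y 2) x (v t x) = _
      rw [fderiv_const_mul (h2d x)]
      simp only [FunLike.coe_smul, Pi.smul_apply, smul_eq_mul]
    have hL : Δ (θ t) x = (1 - μ t) * ∑ i : Fin 3, fderiv ℝ (fun y => fderiv ℝ (fun y' => v t y' 2) y
        (EuclideanSpace.single i (1 : ℝ))) x (EuclideanSpace.single i (1 : ℝ)) := by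
      have hfun : θ t = (1 - μ t) • fun y => v t y 2 := by
        funext y; simp [hθdef]
      rw [hfun, InnerProductSpace.laplacian_smul (1 - μ t) h2.contDiffAt, smul_eq_mul,
        laplacian_eq_sum_fderiv_fderiv h2]
    -- the vertical momentum equation and the spatially constant shifted residual
    have hv := vertical_equation_coord hrate hcont hmild hdiv ht x
    rw [(hasDerivAt_vert hrate hcont hmild hdiv ht x).deriv] at hv
    have hcst := vsub_const_liminf hrate hcont hmild hdiv hpol hμneg hμd hslope hM ht x
    have hne : 1 - μ t ≠ 0 := (hm t ht).ne'
    rw [hT, hX, hL, hsrc]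
    simp only [hκ]
    have e1 : (0 - deriv μ t) * v t x 2 + (1 - μ t) * deriv (fun s => v s x) t 2 +
        (1 - μ t) * fderiv ℝ (fun y => v t y 2) x (v t x) -
        (1 - μ t) * ∑ i : Fin 3, fderiv ℝ (fun y => fderiv ℝ (fun y' => v t y' 2) y
          (EuclideanSpace.single i (1 : ℝ))) x (EuclideanSpace.single i (1 : ℝ)) =
        (1 - μ t) * ((timeDerivWithin (Iio 0) v t x + convect (v t) (v t) x - Δ (v t) x) 2 -
          deriv μ t / (1 - μ t) * v t x 2) := by
      rw [← hv]
      have hc : (1 - μ t) * (deriv μ t / (1 - μ t)) = deriv μ t := by field_simp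
      linear_combination (v t x 2) * hc
    rw [e1, hcst]
  -- ## the decaying slope
  have hsl : ∀ t < 0, ∀ x, |θ t x - θ t 0| ≤ ε t * ‖x - 0‖ := by
    intro t ht x
    have hC1 : ContDiff ℝ 1 (v t) := (hA.contDiff_slice ht).of_le (by norm_cast)
    have hd : Differentiable ℝ (v t) := hC1.differentiable one_ne_zero
    have hmv : ‖v t x - v t 0‖ ≤ C₁ / (-t) * ‖x - 0‖ :=
      (convex_univ).norm_image_sub_le_of_norm_fderiv_le (fun y _ => hd y) (fun y _ => hC₁ t ht y)
        (mem_univ 0) (mem_univ x)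
    have h2 : |v t x 2 - v t 0 2| ≤ C₁ / (-t) * ‖x - 0‖ := by
      have h := abs_apply_le_norm (v t x - v t 0) 2
      have hsub : (v t x - v t 0) 2 = v t x 2 - v t 0 2 := by simp
      rw [hsub] at h
      exact h.trans hmv
    show |(1 - μ t) * v t x 2 - (1 - μ t) * v t 0 2| ≤ (1 - μ t) * (C₁ / (-t)) * ‖x - 0‖
    rw [← mul_sub, abs_mul, abs_of_pos (hm t ht), mul_assoc]
    exact mul_le_mul_of_nonneg_left h2 (hm t ht).le
  have hεc : ContinuousOn ε (Iio 0) :=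
    (continuousOn_const.sub hμ2.continuousOn).mul (continuousOn_rate C₁)
  -- ## `ε(τ)√(−τ) = (1−μ(τ))C₁/√(−τ) ≤ (1+M)C₁/√(−τ)` is small at the early times where `μ ≥ −M`
  have hseq : ∀ δ : ℝ, 0 < δ → ∀ T : ℝ, ∃ t₀ < T, ε t₀ * Real.sqrt (-t₀) < δ := by
    intro δ hδ T
    obtain ⟨t₀, ht₀T, hμt₀⟩ := hM (min T (min (-1) (-(((1 + M) * C₁ / δ) ^ 2) - 1)))
    have ht₀T' : t₀ < T := lt_of_lt_of_le ht₀T (min_le_left _ _)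
    have ht₀1 : t₀ < -1 := lt_of_lt_of_le ht₀T ((min_le_right _ _).trans (min_le_left _ _))
    have ht₀q : ((1 + M) * C₁ / δ) ^ 2 + 1 < -t₀ := by
      have h := lt_of_lt_of_le ht₀T ((min_le_right _ _).trans (min_le_right _ _))
      linarith
    have ht₀ : t₀ < 0 := by linarith
    have hnt₀ : 0 < -t₀ := neg_pos.2 ht₀
    refine ⟨t₀, ht₀T', ?_⟩
    set s : ℝ := Real.sqrt (-t₀) with hs
    have hs0 : 0 < s := Real.sqrt_pos.2 hnt₀
    have hss : s * s = -t₀ := Real.mul_self_sqrt hnt₀.le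
    have hsne : s ≠ 0 := hs0.ne'
    have hδne : δ ≠ 0 := hδ.ne'
    have hM1 : 1 - μ t₀ ≤ 1 + M := by linarith
    have hq : (1 + M) * C₁ / δ < s := by
      have h1 : ((1 + M) * C₁ / δ) ^ 2 < s ^ 2 := by nlinarith
      exact lt_of_pow_lt_pow_left₀ 2 hs0.le h1
    -- `ε t₀ √(−t₀) = (1 − μ t₀) C₁ / s`
    have e : ε t₀ * Real.sqrt (-t₀) = (1 - μ t₀) * C₁ / s := by
      simp only [hεdef]
      rw [← hs, ← hss]
      field_simp
    rw [e, div_lt_iff₀ hs0]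
    calc (1 - μ t₀) * C₁ ≤ (1 + M) * C₁ := mul_le_mul_of_nonneg_right hM1 hC₁0
      _ = (1 + M) * C₁ / δ * δ := by field_simp
      _ < s * δ := mul_lt_mul_of_pos_right hq hδ
      _ = δ * s := mul_comm _ _
  -- ## L4 (sequential): `θ(t,·)` is constant, hence `v₂(t,·)` is
  have hconst := slice_const_of_decayingSlope_seq hrate hcont θ src ε hθ heq hsl hεc hseq
  have hv2 : ∀ t < 0, ∀ x, v t x 2 = v t 0 2 := by
    intro t ht x
    have h := hconst t ht x
    simp only [hθdef] at h
    exact mul_left_cancel₀ (hm t ht).ne' h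
  -- ## hence `v·e₃` is flat along `e₀` on the slice `−1`
  have hs : (-1 : ℝ) < 0 := by norm_num
  have hflat : ∀ y, ⟪fderiv ℝ (v (-1)) y (EuclideanSpace.single 0 1), EuclideanSpace.single 2 1⟫_ℝ = 0 := by
    intro y
    have hd : DifferentiableAt ℝ (v (-1)) y := ((hA.contDiff_slice hs).differentiable (by simp)) y
    have hfun : (fun z => v (-1) z 2) = fun _ => v (-1) 0 2 := funext fun z => hv2 (-1) hs z
    have h1 : fderiv ℝ (fun z => v (-1) z 2) y (EuclideanSpace.single 0 1) = 0 := by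
      rw [hfun, fderiv_fun_const]; rfl
    rw [fderiv_coord_apply hd 2] at h1
    simpa [EuclideanSpace.inner_single_right] using h1
  have he0 : (EuclideanSpace.single 0 1 : EuclideanSpace ℝ (Fin 3)) ≠ 0 := fun h0 => by
    simpa using congrArg (fun w : EuclideanSpace ℝ (Fin 3) => w 0) h0
  have he03 : ⟪(EuclideanSpace.single 0 1 : EuclideanSpace ℝ (Fin 3)), EuclideanSpace.single 2 1⟫_ℝ = 0 := by
    simp [EuclideanSpace.inner_single_left]
  exact eq_zero_of_flat_slice hrate hcont hmild hdiv hs (hpol (-1) hs) he0 he03 hflat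

/-- **(TV) with slope bounded along a sequence ⇒ not backward-singular** (the stub's currency). -/
theorem nonflatLiouville_of_timeShear_liminf (hμa : ∀ s < 0, AnalyticAt ℝ μ s)
    {M : ℝ} (hM : ∀ T : ℝ, ∃ τ < T, -M ≤ μ τ) : ¬ IsBackwardSingularPoint v 0 :=
  not_backwardSingular_of_zero (eq_zero_of_timeShear_liminf hrate hcont hmild hdiv hpol hμneg hslope hμa hM)

end Class

/-- **STUB `stub_tvLiminf` of the line `lrc-jet` (skeleton v2, registered 2026-08-27T09:52Z) — PROVED, verbatim
signature.**  For a profile of the route's Type-I class, poloidal along `e₃`: if every slice `s < 0` is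
proportional-shear, `∂₂v_b(s,·) ≡ μ(s) ∂_b v₂(s,·)` (`b = 0,1`), with a slope function `μ` that is negative and
real-analytic at every `s < 0`, non-constant, and bounded below along SOME sequence of times tending to `−∞`
(`∃ M, ∀ T, ∃ τ < T, −M ≤ μ τ`), then `v` is not backward-singular at the apex.  (The non-constancy clause is not used:
the constant case is this seat's p511024.) -/
theorem stub_tvLiminf :
    ∀ (C : ℝ) (v : ℝ → EuclideanSpace ℝ (Fin 3) → EuclideanSpace ℝ (Fin 3)),
      Literature.Analysis.FluidPDE.HasTypeITimeDecay C v →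
      ContinuousOn (Function.uncurry v) (Set.Iio (0 : ℝ) ×ˢ Set.univ) →
      (∀ s t : ℝ, s < t → t < 0 → ∀ x, v t x =
        Literature.Analysis.UnboundedOperators.heatExtension (v s) (t - s) x -
          Literature.Analysis.FluidPDE.oseenDuhamel 1 s v v t x) →
      (∀ t < 0, Literature.Analysis.FluidPDE.VectorCalculus.IsDivFree (v t)) →
      (∀ s < 0, ∀ y, ⟪Literature.Analysis.FluidPDE.curl (v s) y, EuclideanSpace.single 2 1⟫_ℝ = 0) →
      ∀ μ : ℝ → ℝ, (∀ s < 0, μ s < 0) → (∀ s < 0, AnalyticAt ℝ μ s) →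
        (∃ s₁ s₂ : ℝ, s₁ < 0 ∧ s₂ < 0 ∧ μ s₁ ≠ μ s₂) →
        (∀ s < 0, ∀ y, ∀ b : Fin 3, b ≠ 2 →
          fderiv ℝ (v s) y (EuclideanSpace.single 2 1) b = μ s * fderiv ℝ (v s) y (EuclideanSpace.single b 1) 2) →
        (∃ M : ℝ, ∀ T : ℝ, ∃ τ < T, -M ≤ μ τ) →
        ¬ Literature.Analysis.FluidPDE.IsBackwardSingularPoint v 0 := by
  intro C v hrate hcont hmild hdiv hpol μ hμneg hμa _ hslope hM
  obtain ⟨M, hM⟩ := hM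
  exact nonflatLiouville_of_timeShear_liminf hrate hcont hmild hdiv hpol hμneg hslope hμa hM

end Summit.NavierStokesRegularity.NavierStokesRegularity.Theorems.PoloidalWindowDoorPoloidalWindowRigidityTimeShearLiminf

end
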